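import Summits.CriticalPhenomena.CardyFormulaZ2.Theorems.CardyDualCurrentCanonicalLimitFromExactCRStubLimitAntiHolomorphic
import Summits.CriticalPhenomena.CardyFormulaZ2.Theorems.CardyDualCurrentTemplateCanonicalLimitNonvacuous
import Summits.CriticalPhenomena.CardyFormulaZ2.Theorems.CardySusyWardDiscretisationFamilyExists

/-!
# No threading of the witness in `CanonicalLimitFromExactCR` (crux stmt-CriticalPhenomena-11394)

Route `CardyDualCurrent`, sub-problem `CriticalPhenomena/CardyFormulaZ2`, line `registered`.
The crux `CanonicalLimitFromExactCR` reads "SOME exactly discrete-holomorphic, deep-window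
non-degenerate finite-range local parafermionic template exists (`DualCurrentTemplateR`, r2)
→ SOME template has the canonical spin-`1/3` scaling limit (`TemplateCanonicalLimit`, r9)"; the
consequent re-chooses its template. The informal intent ("exact discrete holomorphicity FORCES
the canonical limit") suggests the THREADED reading: every exactly-CR non-degenerate template
has the canonical limit `θ_δ · C · δ^{-1/3} · T.obs (E δ) ⌊w/δ⌋ i → q` (`q³ = ψ'/ψ`). This file
proves, kernel-checked, that the threaded reading is FALSE whenever it is not vacuous — in the
strongest projective form — so no reshape of the line may thread the witness, and the crux
carries exactly the content `¬ r2 ∨ r9` (companion file `…CanonicalLimitFromExactCRReduction`):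

* `conjStagger_projective_false` — RIGIDITY: along one discretisation family of one Dobrushin
  domain, a template `T` and its conjugate-staggering `T†` (`…StubLimitAntiHolomorphic`:
  `T†.obs = conj T.obs` on horizontal edges) cannot BOTH have their horizontal observables
  converge to a holomorphic cube root `q` of `ψ'/ψ` after ANY complex, `w`-independent
  renormalisations `c_δ`, `c'_δ`;
* `not_both_projective`, `exists_not_projective` — hence, if some exactly-CR non-degenerate
  template exists, some exactly-CR non-degenerate template (`T` or `T†`) has NO projective
  limit: for some domain, family, chordal map, cube root and edge type, no renormalisation
  `c_δ · T.obs` tends to `q` locally uniformly (a fortiori none of the form `θ_δ C δ^{-σ}`);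
* `not_forall_canonicalLimit_of_dualCurrentTemplateR` — the route-shaped corollary (`σ = 1/3`,
  verbatim the inner body of `TemplateCanonicalLimit` for `T`):
  `DualCurrentTemplateR → ¬ ∀ T, T.IsExactCR → T.Nondegenerate → (canonical limit of T)`.

Mechanism: exact CR and non-degeneracy are invariant under `T ↦ T†`. If `c_δ T.obs (·,0) → q`
and `c'_δ conj (T.obs (·,0)) → q` pointwise on `D`, the `δ`-dependent ratio `c'_δ / conj c_δ`
converges to `q w / conj (q w)` at EVERY `w ∈ D`, forcing `w ↦ q w / conj (q w)` to be constant;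
by the open mapping theorem `q` is then constant (`div_conj_not_const`), i.e. `ψ'/ψ` is constant
and `ψ = a · exp (λ w)` is bounded on the bounded domain `D` — impossible for a conformal map ONTO
`ℍ` (`cubeRoot_not_const`). Families exist by `DiscretisationFamilyExists_proof` (stmt-9644).
-/

noncomputable section

namespace Summit.CriticalPhenomena.CardyFormulaZ2.Cruxes.CanonicalLimitFromExactCR.Birth

open scoped Topology ComplexConjugate
open Filter Set Metric Complex MeasureTheory
open Literature.Probability.LatticeModels Literature.Probability.RandomPlanarGeometry
open Summit.CriticalPhenomena.CardyFormulaZ2.Theses.CardyDualCurrent (DualCurrentTemplateR)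
open Summit.CriticalPhenomena.CardyFormulaZ2.Theorems (templateCanonicalLimit_target_nonempty
  DiscretisationFamilyExists_proof)
open AntiHolomorphic (conjStagger obs_conjStagger_zero obs_conjStagger_one isExactCRIn_conjStagger)

namespace Obstruction

/-! ### Conjugate-staggering preserves exact CR and non-degeneracy -/

/-- Exact CR (in all admissible domains) is invariant under conjugate-staggering. [folklore] -/
theorem isExactCR_conjStagger {T : LocalParafermionicTemplate} (h : T.IsExactCR) :
    (conjStagger T).IsExactCR :=
  fun Dd hadm hconn => isExactCRIn_conjStagger (h Dd hadm hconn)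

/-- Constancy on deep vertices is invariant under conjugate-staggering (`conj` is injective).
[folklore] -/
theorem isConstantIn_conjStagger_iff (T : LocalParafermionicTemplate) (Dd : DiscreteDobrushin) :
    (conjStagger T).IsConstantIn Dd ↔ T.IsConstantIn Dd := by
  unfold LocalParafermionicTemplate.IsConstantIn
  have hr : (conjStagger T).r = T.r := rfl
  simp only [hr]
  constructor
  · intro h x x' i hx hx'
    have key := h x x' i hx hx'
    fin_cases i
    · simp only [Fin.zero_eta, Fin.isValue, obs_conjStagger_zero] at key
      exact (starRingEnd ℂ).injective key
    · simp only [Fin.mk_one, Fin.isValue, obs_conjStagger_one, neg_inj] at key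
      exact (starRingEnd ℂ).injective key
  · intro h x x' i hx hx'
    fin_cases i
    · have key := h x x' 0 hx hx'
      simp only [Fin.zero_eta, Fin.isValue, obs_conjStagger_zero, key]
    · have key := h x x' 1 hx hx'
      simp only [Fin.mk_one, Fin.isValue, obs_conjStagger_one, key]

/-- Non-degeneracy is invariant under conjugate-staggering. [folklore] -/
theorem nondegenerate_conjStagger {T : LocalParafermionicTemplate} (h : T.Nondegenerate) :
    (conjStagger T).Nondegenerate :=
  fun hall => h fun Dd hadm hconn => (isConstantIn_conjStagger_iff T Dd).1 (hall Dd hadm hconn)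

/-! ### Two facts of complex analysis on a Dobrushin domain -/

/-- **A holomorphic cube root of `ψ'/ψ` is never constant.** If `q ≡ c` on `D` with
`q³ = ψ'/ψ`, `ψ = φ⁻¹ : D → ℍ` a conformal equivalence, then `ψ' = c³ ψ`, so
`ψ = a · exp (c³ w)` on the (open, connected) domain, hence `ψ` is bounded on the bounded set
`D` — but `ψ` maps `D` ONTO the unbounded half-plane `ℍ`. [folklore] -/
theorem cubeRoot_not_const (D : DobrushinDomain)
    (φ : ConformalEquiv UpperHalfPlane.upperHalfPlaneSet D.carrier) {q : ℂ → ℂ}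
    (hq3 : ∀ w ∈ D.carrier, q w ^ 3 = deriv φ.symm w / φ.symm w) {c : ℂ}
    (hc : ∀ w ∈ D.carrier, q w = c) : False := by
  have hψd : DifferentiableOn ℂ φ.symm D.carrier := φ.symm.differentiableOn_coe
  have hψ0 : ∀ w ∈ D.carrier, φ.symm w ≠ 0 := by
    intro w hw h0
    have hmem : 0 < (φ.symm w).im := φ.symm_mapsTo hw
    rw [h0] at hmem
    simp at hmem
  -- `ψ' = c³ ψ` on `D`
  have hderiv : ∀ w ∈ D.carrier, deriv φ.symm w = c ^ 3 * φ.symm w := by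
    intro w hw
    have h := hq3 w hw
    rw [hc w hw, eq_div_iff (hψ0 w hw)] at h
    exact h.symm
  -- `F = ψ · exp (-c³ w)` has zero derivative on `D`, hence is constant
  set F : ℂ → ℂ := fun w => φ.symm w * exp (-c ^ 3 * w) with hF
  have hexp : ∀ w, HasDerivAt (fun w : ℂ => exp (-c ^ 3 * w)) (exp (-c ^ 3 * w) * (-c ^ 3)) w := by
    intro w
    have h := ((hasDerivAt_id w).const_mul (-c ^ 3)).cexp
    simpa using h
  have hFderiv : ∀ w ∈ D.carrier, HasDerivAt F 0 w := by
    intro w hw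
    have h1 : HasDerivAt (φ.symm : ℂ → ℂ) (deriv φ.symm w) w :=
      (hψd.differentiableAt (D.isOpen.mem_nhds hw)).hasDerivAt
    have h2 := h1.mul (hexp w)
    have e : deriv φ.symm w * exp (-c ^ 3 * w) + φ.symm w * (exp (-c ^ 3 * w) * (-c ^ 3)) = 0 := by
      rw [hderiv w hw]; ring
    rw [e] at h2
    exact h2
  have hFd : DifferentiableOn ℂ F D.carrier := fun w hw =>
    (hFderiv w hw).differentiableAt.differentiableWithinAt
  obtain ⟨a, ha⟩ := D.isOpen.exists_is_const_of_deriv_eq_zero D.isConnected.isPreconnected hFd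
    (fun w hw => (hFderiv w hw).deriv)
  -- so `ψ = a · exp (c³ w)` is bounded on `D`
  obtain ⟨R, hR⟩ := D.isBounded.exists_norm_le
  have hbound : ∀ w ∈ D.carrier, ‖φ.symm w‖ ≤ ‖a‖ * Real.exp (‖c ^ 3‖ * R) := by
    intro w hw
    have hFw : φ.symm w * exp (-c ^ 3 * w) = a := ha w hw
    have hψw : φ.symm w = a * exp (c ^ 3 * w) := by
      rw [← hFw, mul_assoc, ← Complex.exp_add]
      simp
    rw [hψw, norm_mul]
    refine mul_le_mul_of_nonneg_left ?_ (norm_nonneg _)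
    refine (Complex.norm_exp_le_exp_norm _).trans ?_
    rw [Real.exp_le_exp, norm_mul]
    exact mul_le_mul_of_nonneg_left (hR w hw) (norm_nonneg _)
  -- but `ψ` is onto `ℍ`, which is unbounded
  set B : ℝ := ‖a‖ * Real.exp (‖c ^ 3‖ * R) with hB
  have hB0 : 0 ≤ B := by positivity
  set ζ : ℂ := ((B + 1 : ℝ) : ℂ) * I with hζ
  have hζmem : ζ ∈ UpperHalfPlane.upperHalfPlaneSet := by
    show 0 < ζ.im
    simp [hζ]
    linarith
  have hwmem : φ ζ ∈ D.carrier := φ.mapsTo hζmem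
  have hψζ : φ.symm (φ ζ) = ζ := φ.symm_apply_apply hζmem
  have hle := hbound (φ ζ) hwmem
  rw [hψζ] at hle
  have hnorm : ‖ζ‖ = B + 1 := by
    rw [hζ, norm_mul, Complex.norm_I, mul_one, Complex.norm_real, Real.norm_eq_abs,
      abs_of_nonneg (by linarith)]
  rw [hnorm] at hle
  linarith

/-- **`q / conj q` is never constant** for a holomorphic cube root `q` of `ψ'/ψ` on a Dobrushin
domain: otherwise, by the open mapping theorem, either `q` is constant (excluded by
`cubeRoot_not_const`) or `q(D)` is an open set contained in the real line `{z | z = ρ conj z}`,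
which contains no two points `z₀ + ε/2`, `z₀ + i ε/2` at once. [folklore] -/
theorem div_conj_not_const (D : DobrushinDomain)
    (φ : ConformalEquiv UpperHalfPlane.upperHalfPlaneSet D.carrier) {q : ℂ → ℂ}
    (hq : DifferentiableOn ℂ q D.carrier)
    (hq3 : ∀ w ∈ D.carrier, q w ^ 3 = deriv φ.symm w / φ.symm w) {ρ : ℂ}
    (hρ : ∀ w ∈ D.carrier, q w = ρ * conj (q w)) : False := by
  rcases (hq.analyticOnNhd D.isOpen).is_constant_or_isOpen D.isConnected.isPreconnected with
    ⟨c, hc⟩ | hopen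
  · exact cubeRoot_not_const D φ hq3 hc
  · obtain ⟨w₀, hw₀⟩ := D.toJordanDomain.nonempty
    have hO : IsOpen (q '' D.carrier) := hopen _ Subset.rfl D.isOpen
    obtain ⟨ε, hε, hball⟩ := Metric.isOpen_iff.1 hO (q w₀) (mem_image_of_mem q hw₀)
    have hε2 : (0 : ℝ) < ε / 2 := by positivity
    have h1 : q w₀ + ((ε / 2 : ℝ) : ℂ) ∈ q '' D.carrier := by
      refine hball ?_
      rw [Metric.mem_ball, dist_eq_norm, add_sub_cancel_left, Complex.norm_real, Real.norm_eq_abs,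
        abs_of_pos hε2]
      linarith
    have h2 : q w₀ + ((ε / 2 : ℝ) : ℂ) * I ∈ q '' D.carrier := by
      refine hball ?_
      rw [Metric.mem_ball, dist_eq_norm, add_sub_cancel_left, norm_mul, Complex.norm_I, mul_one,
        Complex.norm_real, Real.norm_eq_abs, abs_of_pos hε2]
      linarith
    obtain ⟨w₁, hw₁, h1e⟩ := h1
    obtain ⟨w₂, hw₂, h2e⟩ := h2
    have e0 := hρ w₀ hw₀
    have e1 := hρ w₁ hw₁
    have e2 := hρ w₂ hw₂
    rw [h1e, map_add, Complex.conj_ofReal, mul_add, ← e0, add_right_inj] at e1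
    rw [h2e, map_add, map_mul, Complex.conj_ofReal, Complex.conj_I, mul_add, ← e0,
      add_right_inj] at e2
    have hε0 : ((ε / 2 : ℝ) : ℂ) ≠ 0 := by exact_mod_cast hε2.ne'
    have hρ1 : ρ = 1 := by
      have h : ρ * ((ε / 2 : ℝ) : ℂ) = 1 * ((ε / 2 : ℝ) : ℂ) := by rw [one_mul]; exact e1.symm
      exact mul_right_cancel₀ hε0 h
    have hρ2 : ρ = -1 := by
      have h : ρ * (((ε / 2 : ℝ) : ℂ) * I) = (-1) * (((ε / 2 : ℝ) : ℂ) * I) := by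
        rw [show ρ * (((ε / 2 : ℝ) : ℂ) * I) = -(ρ * (((ε / 2 : ℝ) : ℂ) * -I)) by ring, ← e2]
        ring
      exact mul_right_cancel₀ (mul_ne_zero hε0 Complex.I_ne_zero) h
    rw [hρ1] at hρ2
    norm_num at hρ2

/-! ### Rigidity: `T` and `T†` cannot both converge projectively along one family -/

/-- **Rigidity core.** Along ONE discretisation family `E` of ONE Dobrushin domain `D`, with one
conformal map `φ : ℍ → D` and one zero-free holomorphic cube root `q` of `ψ'/ψ` (`ψ = φ⁻¹`): if
`c_δ · T.obs (E δ) ⌊w/δ⌋ 0 → q` and `c'_δ · T†.obs (E δ) ⌊w/δ⌋ 0 → q` locally uniformly on `D`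
for SOME complex renormalisations `c`, `c'` (`T†` the conjugate-staggered template,
`T†.obs (·, 0) = conj T.obs (·, 0)`), then — since the ratio `c'_δ / conj c_δ`, a function of `δ`
alone, tends to `q w / conj (q w)` at every `w ∈ D` — the function `q / conj q` is constant on
`D`, contradicting `div_conj_not_const`. [folklore] -/
theorem conjStagger_projective_false (T : LocalParafermionicTemplate)
    {D : DobrushinDomain} {E : ℝ → DiscreteDobrushin}
    (φ : ConformalEquiv UpperHalfPlane.upperHalfPlaneSet D.carrier) {q : ℂ → ℂ}
    (hq : DifferentiableOn ℂ q D.carrier)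
    (hq3 : ∀ w ∈ D.carrier, q w ^ 3 = deriv φ.symm w / φ.symm w)
    (hq0 : ∀ w ∈ D.carrier, q w ≠ 0) {c c' : ℝ → ℂ}
    (h : TendstoLocallyUniformlyOn
      (fun (δ : ℝ) (w : ℂ) => c δ * T.obs (E δ) (fun j => ⌊(if j = 0 then w.re else w.im) / δ⌋) 0)
      q (𝓝[>] (0 : ℝ)) D.carrier)
    (h' : TendstoLocallyUniformlyOn
      (fun (δ : ℝ) (w : ℂ) => c' δ *
        (conjStagger T).obs (E δ) (fun j => ⌊(if j = 0 then w.re else w.im) / δ⌋) 0)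
      q (𝓝[>] (0 : ℝ)) D.carrier) : False := by
  set u : ℝ → ℂ := fun δ => c' δ / conj (c δ) with hu
  -- the ratio tends to `q w / conj (q w)` at every point
  have key : ∀ w ∈ D.carrier, Tendsto u (𝓝[>] (0 : ℝ)) (𝓝 (q w / conj (q w))) := by
    intro w hw
    have hF := h.tendsto_at hw
    have hF' := h'.tendsto_at hw
    have hqc : conj (q w) ≠ 0 := by
      rw [map_ne_zero]
      exact hq0 w hw
    have hFc : Tendsto (fun δ : ℝ => conj (c δ *
        T.obs (E δ) (fun j => ⌊(if j = 0 then w.re else w.im) / δ⌋) 0)) (𝓝[>] (0 : ℝ))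
        (𝓝 (conj (q w))) :=
      (Complex.continuous_conj.tendsto _).comp hF
    have hdiv := hF'.div hFc hqc
    refine hdiv.congr' ?_
    filter_upwards [hFc.eventually_ne hqc] with δ hδ
    simp only [Pi.div_apply, map_mul] at hδ ⊢
    rw [obs_conjStagger_zero, hu]
    have h2 := left_ne_zero_of_mul hδ
    rw [div_eq_div_iff hδ h2]
    ring
  -- hence `q / conj q` is constant on `D`
  obtain ⟨w₀, hw₀⟩ := D.toJordanDomain.nonempty
  have hρ : ∀ w ∈ D.carrier, q w = (q w₀ / conj (q w₀)) * conj (q w) := by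
    intro w hw
    have hqc : conj (q w) ≠ 0 := by
      rw [map_ne_zero]
      exact hq0 w hw
    rw [← tendsto_nhds_unique (key w hw) (key w₀ hw₀), div_mul_cancel₀ _ hqc]
  exact div_conj_not_const D φ hq hq3 hρ

/-! ### The obstruction theorems

The "projective limit of `T` itself" property is written out in full each time (no auxiliary
definition): for every Dobrushin domain `D`, every `ZdDiscretisationFamily E`, every chordal
uniformizer `φ` (`ψ = φ⁻¹`), every holomorphic cube root `q` of `ψ'/ψ` and each edge type `i`, SOME
complex renormalisation `c_δ` makes `c_δ · T.obs (E δ) ⌊w/δ⌋ i → q` locally uniformly on `D`. -/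

/-- **`T` and `T†` cannot both have a projective limit** (one domain — the unit disc —, one
family (`DiscretisationFamilyExists_proof`), one chordal map and cube root
(`templateCanonicalLimit_target_nonempty`) and the horizontal edge type already clash, by
`conjStagger_projective_false`). [folklore] -/
theorem not_both_projective (T : LocalParafermionicTemplate)
    (hT : ∀ (D : DobrushinDomain) (E : ℝ → DiscreteDobrushin), ZdDiscretisationFamily D E →
      ∀ (φ : ConformalEquiv UpperHalfPlane.upperHalfPlaneSet D.carrier),
        D.IsChordalUniformizing φ →
      ∀ q : ℂ → ℂ, DifferentiableOn ℂ q D.carrier →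
        (∀ w ∈ D.carrier, q w ^ 3 = deriv φ.symm w / φ.symm w) →
      ∀ i : Fin 2, ∃ c : ℝ → ℂ,
        TendstoLocallyUniformlyOn
          (fun (δ : ℝ) (w : ℂ) => c δ *
            T.obs (E δ) (fun j => ⌊(if j = 0 then w.re else w.im) / δ⌋) i)
          q (𝓝[>] (0 : ℝ)) D.carrier)
    (hT' : ∀ (D : DobrushinDomain) (E : ℝ → DiscreteDobrushin), ZdDiscretisationFamily D E →
      ∀ (φ : ConformalEquiv UpperHalfPlane.upperHalfPlaneSet D.carrier),
        D.IsChordalUniformizing φ →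
      ∀ q : ℂ → ℂ, DifferentiableOn ℂ q D.carrier →
        (∀ w ∈ D.carrier, q w ^ 3 = deriv φ.symm w / φ.symm w) →
      ∀ i : Fin 2, ∃ c : ℝ → ℂ,
        TendstoLocallyUniformlyOn
          (fun (δ : ℝ) (w : ℂ) => c δ *
            (conjStagger T).obs (E δ) (fun j => ⌊(if j = 0 then w.re else w.im) / δ⌋) i)
          q (𝓝[>] (0 : ℝ)) D.carrier) : False := by
  set D : DobrushinDomain := DobrushinDomain.unitDisc with hD
  obtain ⟨E, h1, h2, h3, h4, h5, h6⟩ := DiscretisationFamilyExists_proof D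
  have hE : ZdDiscretisationFamily D E := ⟨h1, h2, h3, h4, h5, h6⟩
  obtain ⟨φ, q, hφ, hq, hq3, hq0⟩ := templateCanonicalLimit_target_nonempty D
  obtain ⟨c, hconv⟩ := hT D E hE φ hφ q hq hq3 0
  obtain ⟨c', hconv'⟩ := hT' D E hE φ hφ q hq hq3 0
  exact conjStagger_projective_false T φ hq hq3 hq0 hconv hconv'

/-- **Projective obstruction.** If some exactly-CR, deep-window non-degenerate finite-range local
parafermionic template exists, then some exactly-CR, non-degenerate template has NO projective
limit: for some Dobrushin domain, discretisation family, chordal map, cube root `q` and edge type,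
no complex renormalisation `c_δ · T.obs` tends to `q` locally uniformly (it is `T` itself or its
conjugate-staggering `T†`). Exact discrete holomorphicity alone therefore does not determine —
not even projectively — the scaling limit of a template. [folklore] -/
theorem exists_not_projective
    (h : ∃ T : LocalParafermionicTemplate, T.IsExactCR ∧ T.Nondegenerate) :
    ∃ T : LocalParafermionicTemplate, T.IsExactCR ∧ T.Nondegenerate ∧
      ¬ ∀ (D : DobrushinDomain) (E : ℝ → DiscreteDobrushin), ZdDiscretisationFamily D E →
        ∀ (φ : ConformalEquiv UpperHalfPlane.upperHalfPlaneSet D.carrier),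
          D.IsChordalUniformizing φ →
        ∀ q : ℂ → ℂ, DifferentiableOn ℂ q D.carrier →
          (∀ w ∈ D.carrier, q w ^ 3 = deriv φ.symm w / φ.symm w) →
        ∀ i : Fin 2, ∃ c : ℝ → ℂ,
          TendstoLocallyUniformlyOn
            (fun (δ : ℝ) (w : ℂ) => c δ *
              T.obs (E δ) (fun j => ⌊(if j = 0 then w.re else w.im) / δ⌋) i)
            q (𝓝[>] (0 : ℝ)) D.carrier := by
  obtain ⟨T, hCR, hND⟩ := h
  by_contra hcon
  push Not at hcon
  exact not_both_projective T (hcon T hCR hND)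
    (hcon (conjStagger T) (isExactCR_conjStagger hCR) (nondegenerate_conjStagger hND))

end Obstruction

/-- **The threaded reading of the crux is false given r2** (registered sub-goal
`not_forall_canonicalLimit_of_dualCurrentTemplateR` of line `registered`): if
`DualCurrentTemplateR` holds, it is NOT the case that every exactly discrete-holomorphic,
deep-window non-degenerate finite-range local parafermionic template `T` has the canonical
spin-`1/3` limit — one lattice constant `C > 0` and, for every Dobrushin domain, every
`ZdDiscretisationFamily`, every chordal uniformizer `φ` (`ψ = φ⁻¹`) and every holomorphic cube root
`q` of `ψ'/ψ`, unit phases `θ_δ` with `θ_δ · C · δ^{-1/3} · T.obs (E δ) ⌊w/δ⌋ i → q` locally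
uniformly on `D` for both edge types (verbatim the inner body of `TemplateCanonicalLimit` for `T`).
So `CanonicalLimitFromExactCR` cannot be proved by threading the witness of its antecedent: its
content is exactly `¬ DualCurrentTemplateR ∨ TemplateCanonicalLimit`. [folklore] -/
theorem not_forall_canonicalLimit_of_dualCurrentTemplateR : Summit.CriticalPhenomena.CardyFormulaZ2.Theses.CardyDualCurrent.DualCurrentTemplateR → ¬ ∀ T : Literature.Probability.LatticeModels.LocalParafermionicTemplate, T.IsExactCR → T.Nondegenerate → ∃ C : ℝ, 0 < C ∧ ∀ (D : Literature.Probability.RandomPlanarGeometry.DobrushinDomain) (E : ℝ → Literature.Probability.LatticeModels.DiscreteDobrushin), Literature.Probability.LatticeModels.ZdDiscretisationFamily D E → ∀ (φ : Literature.Probability.RandomPlanarGeometry.ConformalEquiv UpperHalfPlane.upperHalfPlaneSet D.carrier), D.IsChordalUniformizing φ → ∀ q : ℂ → ℂ, DifferentiableOn ℂ q D.carrier → (∀ w ∈ D.carrier, q w ^ 3 = deriv φ.symm w / φ.symm w) → ∃ θ : ℝ → ℂ, (∀ δ, ‖θ δ‖ = 1) ∧ ∀ i : Fin 2, TendstoLocallyUniformlyOn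 (fun (δ : ℝ) (w : ℂ) => θ δ * C * ((δ ^ (-(1 / 3 : ℝ)) : ℝ) : ℂ) * T.obs (E δ) (fun j => ⌊(if j = 0 then w.re else w.im) / δ⌋) i) q (𝓝[>] (0 : ℝ)) D.carrier := by
  intro h2 hall
  have hex : ∃ T : LocalParafermionicTemplate, T.IsExactCR ∧ T.Nondegenerate :=
    LocalParafermionicTemplate.exists_isExactCR_and_nondegenerate_iff.2 h2
  obtain ⟨T, hCR, hND, hT⟩ := Obstruction.exists_not_projective hex
  refine hT fun D E hE φ hφ q hq hq3 i => ?_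
  obtain ⟨C, -, hrest⟩ := hall T hCR hND
  obtain ⟨θ, -, hconv⟩ := hrest D E hE φ hφ q hq hq3
  exact ⟨fun δ => θ δ * C * ((δ ^ (-(1 / 3 : ℝ)) : ℝ) : ℂ), hconv i⟩

end Summit.CriticalPhenomena.CardyFormulaZ2.Cruxes.CanonicalLimitFromExactCR.Birth

end
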